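import Literature.AlgebraicGeometry.Resolution.ValuedFunctionFields
import Mathlib.RingTheory.Smooth.Locus
import Mathlib.RingTheory.Localization.AtPrime.Basic
import Mathlib.FieldTheory.PurelyInseparable.Basic
import HarnessLib

/-!
# Relative one-dimensional inseparable local uniformization (Temkin 2013, §2.8 and Thm. 3.3.1)

Topic: `Literature/AlgebraicGeometry/Resolution`. The deep input of the induction step on the
transcendence defect in M. Temkin, *Inseparable local uniformization*, J. Algebra 373 (2013)
65–119 = arXiv:0804.1554v3 (numbers and pages of the journal version = v3): Step 1 of the proof
of Thm. 4.1.1 (p. 47) fibres `X` by curves over a valued field `k̄ ⊆ K` with `tr.deg._{k̄}(K) = 1`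
and `K/k̄` transcendentally immediate (`exists_intermediateField_trdeg_eq_one_isTranscendentallyImmediateOver`,
`TranscendentallyImmediate.lean`) and then "Theorem 3.3.1 applies to `C`, `Kᵢ/K` and `S`". This
file vendors the vocabulary of §2.8 and Thm. 3.3.1 itself, one layer below the named fact
`Temkin2013DescentDefectStep` (`InseparableLocalUniformizationDefect.lean`), which packages it
together with Prop. 2.3.8 and Lemmas 2.3.9, 2.8.4, 2.8.5.

* `AreSmoothEquivalent f g p q` — **Definition 2.8.1** (p. 29: "Let `S` be a scheme and `X`, `Y`
  be two `S`-schemes. We say that points `x ∈ X` and `y ∈ Y` are smooth-equivalent over `S` if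
  there exists an `S`-scheme `Z` with a point `z ∈ Z` and smooth `S`-morphisms `Z → X` and `Z → Y`
  which map `z` to `x` and `y`, respectively (alternatively, one could say that `X` and `Y` are
  smooth-locally `S`-isomorphic at `x` and `y`)"), rendered for AFFINE `S = Spec R₀`,
  `X = Spec A`, `Y = Spec B` (structure maps `f : R₀ →+* A`, `g : R₀ →+* B`; points = prime
  ideals `p`, `q`): there is a ring `D` with algebra structures over `A` and `B` inducing the
  same `R₀`-structure (an `S`-scheme `Z = Spec D` with `S`-morphisms to `X` and `Y`), both SMOOTH
  (`Algebra.Smooth` = formally smooth and finitely presented, i.e. `Spec D → Spec A`,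
  `Spec D → Spec B` are smooth morphisms), and a prime `r` of `D` lying over `p` and over `q`.
  Restricting to affine `Z` loses nothing: a point `z` of an arbitrary `Z` has an affine open
  neighbourhood, and the restrictions of smooth morphisms to it are smooth. API, PROVED:
  `AreSmoothEquivalent.refl`, `.symm`, and `.of_isSmoothAt` — a point of a finitely presented
  `R₀`-algebra at which it is smooth is smooth-equivalent over `R₀` to its image in `Spec R₀`
  (the direction "⇐" of the example after Definition 2.8.1, p. 30: "for a field `k` and a
  `k`-variety `X`, a point `x ∈ X` is smooth-equivalent to `(Spec(k), Spec(k))` if and only if `X`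
  is `k`-smooth at `x`"; "⇒", descent of smoothness along a smooth morphism, EGA IV 17.7.7, is
  not vendored).
* `ringChar_residueField_eq_of_algebraMap_mem` — PROVED: a valuation ring containing a field has
  residue field of the same characteristic as its fraction field (equicharacteristic), the form in
  which the characteristic hypothesis of Thm. 3.3.1 is met in Thm. 4.1.1, Step 1.
* `IsAffineNormalizedModel O R₀ A` — "an affine normalized `S`-model of `K°`" for `S = Spec k°`,
  `k° ↦ R₀ ⊆ K` (§3.3, p. 44: "`C = Spec(A)` … in the sense that `C` is a normal nft `S`-scheme
  with generic point `Spec(K) → C` and such that `K°` is centered on `C`"; nft = "normalized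
  finite type", Definition 2.2.2, p. 11: "a composition of a partial normalization `Y → Y₀` and
  an admissible morphism `Y₀ → X` of finite type"): `A` is the integral closure in `K` of a
  finitely generated `R₀`-subalgebra `R₀[f₁, …, f_n]` of `K°` and `Frac A = K` — the form in
  which such models arise in the paper (proof of Thm. 4.1.1, Step 2, p. 48: "`C' = Spec(A)`,
  where `A` is the normalization of a subring `k̄°[f₁, …, f_n] ⊂ K°`"). Indeed a normal domain
  `A` with `Frac A = K` which is a partial normalization of a finite type `k°`-algebra
  `A₀ ⊆ A ⊆ Nr(A₀)` is `Nr_K(A₀)`, and `K°` is centred on `Spec A` iff `A ⊆ K°` iff the `fᵢ` lie in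
  `K°`. A refinement `C' → C` of such models is an inclusion `A ⊆ A'`.
* `Temkin2013RelativeCurve` — NAMED FACT, **Thm. 3.3.1 in the case `n = 1`** (p. 44), in the
  setting of §3.3: `k` an EQUICHARACTERISTIC valued field of height one (`char k̃ = char k`; see
  the rendering notes), `K/k` a finitely generated extension of
  valued fields of transcendence degree one with `K` of height one and `K/k` transcendentally
  immediate, `C` an affine normalized `S`-model of `K°`, `K₁/K` a finite extension of valued
  fields; conclusion: a refinement `C'` of `C` and finite extensions of valued fields `l/k`
  purely inseparable and `m₁/l` separable such that the centre `z₁` of `L₁° = (lK₁)°` on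
  `Nr_{L₁}(C')` is smooth-equivalent over `S` to the closed point of `S₁ = Spec(m₁°)`. Its
  printed proof is the decompletion (§3.3) of the Berkovich-analytic Thm. 3.2.6 (inseparable
  uniformization of terminal points on analytic curves over deeply ramified fields), resting on
  the stable modification theorem of [Tem3]; none of this is available in Mathlib.

## Sources

* M. Temkin, *Inseparable local uniformization*, J. Algebra 373 (2013) 65–119 =
  arXiv:0804.1554v3: §2.2, Definition 2.2.2 (p. 11); §2.8, Definition 2.8.1 and the paragraph
  after it (pp. 29–30); §3 (p. 31: "Throughout §3, `k` is a valued field of height one and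
  `p = char(k̃)`. We allow the case of `p = 0` for the sake of completeness"); Thm. 3.2.6 and
  Remark 3.2.8 (p. 42, resp. p. 44: equicharacteristic base; mixed characteristic excluded); §3.3 and
  Thm. 3.3.1 (p. 44); proof of Thm. 4.1.1, Steps 1–2 (pp. 47–48).

## Rendering notes

* Smooth-equivalence: base and targets are ring homomorphisms `f : R₀ →+* A`, `g : R₀ →+* B`
  rather than `Algebra` instances, so that subrings of different fields over a common valuation
  ring (`Nr_{L₁}(C') ⊆ L₁` and `m₁° ⊆ m₁` over `k°` in Thm. 3.3.1) are compared without instance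
  plumbing; "`S`-morphisms" is the equation `(A → D) ∘ f = (B → D) ∘ g`; all rings in one
  universe `u` (the witness `D : Type u`).
* Valued fields as in the companion files: a field with a `ValuationSubring`; "`K/k` extension of
  valued fields" ↦ `O.comap (algebraMap k K) = O_k`; height one ↦ `ringKrullDim = 1`; `k°` inside
  `K` ↦ the subring `O_k.toSubring.map (algebraMap k K)`; "`K/k` transcendentally immediate" ↦
  `IsValueTorsionOver O (algebraMap k K).fieldRange ⊤ ∧ IsResiduallyAlgebraicOver O … ⊤`
  (`ValuedFunctionFields.lean`; definitionally the `IsTranscendentallyImmediateOver` of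
  `TranscendentallyImmediate.lean`, spelled out so that this file does not depend on it).
* Thm. 3.3.1's extensions: `L₁ = lK₁` is a field `L₁ ⊇ K₁`, finite purely inseparable over `K₁`,
  with `l ⊆ L₁` finite purely inseparable over `k` and `K₁[l] = L₁`, valued by THE valuation ring
  `O₁'` over `K₁°` (unique by pure inseparability; its restriction to `l` is the unique extension
  of `k°` to `l`, which is how "the finite extension of valued fields `l/k`" is valued);
  `m₁/l` is a field `m₁ ⊇ l`, finite separable over `l`, with a valuation ring `m₁°` over `l°`.
  The `k°`-structures of `Nr_{L₁}(C')` and `m₁°` needed for "over `S`" are the obvious maps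
  `k° → L₁`, `k° → m₁`; that they land in `Nr_{L₁}(C')`, resp. `m₁°`, is provable from the other
  conjuncts and is quantified existentially (`hkN`, `hkm`) only to form the ring homomorphisms.
* Characteristic: §3.3 opens with "`k` is a valued field of height 1 and positive characteristic
  `p`"; §3 (p. 31) sets `p = char(k̃)` and allows `p = 0`; but the proof of Thm. 3.3.1 (Step 2)
  invokes Thm. 3.2.6, stated for an EQUICHARACTERISTIC analytic field, the mixed characteristic
  case being explicitly excluded ("see Remark 3.2.8": "It seems that Theorem 3.2.6 holds for any
  base field `k` with …" — not claimed). The fact therefore carries the hypothesis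
  `ringChar k̃ = ringChar k` (equal characteristic, `p = 0` included), which holds in the paper's
  application (Thm. 4.1.1, Step 1: `k = k̄` contains the trivially valued ground field, so `k̄°`
  and its residue field are algebras over it).
* Numbering in the earlier arXiv version held in the literature store (41 pp.) differs from the
  journal = v3 numbering used here: smooth-equivalence is §2.7 there (Definition 2.7.1, Lemmas
  2.7.4/2.7.5), "transcendentally immediate" is called "essentially immediate", Thm. 3.3.1 keeps
  its number (its proof's Step 2 is on p. 27), and the mixed-characteristic caveat is Remark
  3.2.7 there (Remark 3.2.8 in v3).
-/
namespace Literature.AlgebraicGeometry.Resolution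

universe u

/-- **Smooth-equivalence of points over a base** (Temkin 2013, Definition 2.8.1, p. 29: "points
`x ∈ X` and `y ∈ Y` are smooth-equivalent over `S` if there exists an `S`-scheme `Z` with a point
`z ∈ Z` and smooth `S`-morphisms `Z → X` and `Z → Y` which map `z` to `x` and `y`,
respectively"), affine rendering: for `S = Spec R₀`, `X = Spec A` and `Y = Spec B` over `S` via
`f : R₀ →+* A`, `g : R₀ →+* B`, the primes `p ⊂ A` and `q ⊂ B` are smooth-equivalent over `R₀`
if there are a ring `D` (the affine `Z`), algebra structures `A → D`, `B → D` agreeing on `R₀`,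
both smooth (`Algebra.Smooth`: formally smooth of finite presentation), and a prime `r ⊂ D`
(the point `z`) with `r ∩ A = p`, `r ∩ B = q`. [cite: Temkin2013, Definition 2.8.1] -/
def AreSmoothEquivalent {R₀ A B : Type u} [CommRing R₀] [CommRing A] [CommRing B]
    (f : R₀ →+* A) (g : R₀ →+* B) (p : Ideal A) (q : Ideal B) : Prop :=
  ∃ (D : Type u) (_ : CommRing D) (_ : Algebra A D) (_ : Algebra B D),
    (algebraMap A D).comp f = (algebraMap B D).comp g ∧
    Algebra.Smooth A D ∧ Algebra.Smooth B D ∧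
    ∃ r : Ideal D, r.IsPrime ∧ r.comap (algebraMap A D) = p ∧ r.comap (algebraMap B D) = q

namespace AreSmoothEquivalent

variable {R₀ A B : Type u} [CommRing R₀] [CommRing A] [CommRing B]

/-- Smooth-equivalence is reflexive at prime ideals (`Z = X`, identity morphisms).
[folklore] -/
theorem refl (f : R₀ →+* A) (p : Ideal A) [hp : p.IsPrime] : AreSmoothEquivalent f f p p := by
  refine ⟨A, inferInstance, Algebra.id A, Algebra.id A, rfl, ?_, ?_, p, hp, ?_, ?_⟩
  · exact ⟨inferInstance, inferInstance⟩
  · exact ⟨inferInstance, inferInstance⟩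
  · exact Ideal.ext fun _ => Iff.rfl
  · exact Ideal.ext fun _ => Iff.rfl

/-- Smooth-equivalence is symmetric. [folklore] -/
theorem symm {f : R₀ →+* A} {g : R₀ →+* B} {p : Ideal A} {q : Ideal B}
    (h : AreSmoothEquivalent f g p q) : AreSmoothEquivalent g f q p := by
  obtain ⟨D, _, _, _, hcomp, hA, hB, r, hr, hrp, hrq⟩ := h
  exact ⟨D, _, _, _, hcomp.symm, hB, hA, r, hr, hrq, hrp⟩

/-- **A smooth point is smooth-equivalent to the base** (Temkin 2013, after Definition 2.8.1,
p. 30: "for a field `k` and a `k`-variety `X`, a point `x ∈ X` is smooth-equivalent to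
`(Spec(k), Spec(k))` if and only if `X` is `k`-smooth at `x`"; here the direction "⇐", over any
base ring): if `A` is a finitely presented `R₀`-algebra which is smooth at the prime `p`
(`Algebra.IsSmoothAt`: `A_p` formally smooth over `R₀`), then `(Spec A, p)` is smooth-equivalent
over `R₀` to `(Spec R₀, p ∩ R₀)`: take `Z = Spec A_f` with `f ∉ p` and `A_f` smooth over `R₀`
(`Algebra.IsSmoothAt.exists_notMem_smooth`); `A → A_f` is smooth (a localization) and the point
is `p A_f`. PROVED. [cite: Temkin2013, Section 2.8 (p. 30)] -/
theorem of_isSmoothAt [Algebra R₀ A] [Algebra.FinitePresentation R₀ A] (p : Ideal A)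
    [hp : p.IsPrime] [Algebra.IsSmoothAt R₀ p] :
    AreSmoothEquivalent (algebraMap R₀ A) (RingHom.id R₀) p (p.comap (algebraMap R₀ A)) := by
  obtain ⟨f, hfp, hsmooth⟩ := Algebra.IsSmoothAt.exists_notMem_smooth R₀ p
  have hdisj : Disjoint (↑(Submonoid.powers f) : Set A) ↑p := by
    refine Set.disjoint_left.mpr ?_
    rintro x ⟨n, rfl⟩ hx
    exact hfp (hp.mem_of_pow_mem n hx)
  have hprime : (p.map (algebraMap A (Localization.Away f))).IsPrime :=
    IsLocalization.isPrime_of_isPrime_disjoint (Submonoid.powers f) _ p hp hdisj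
  have hcomap : (p.map (algebraMap A (Localization.Away f))).comap
      (algebraMap A (Localization.Away f)) = p :=
    IsLocalization.under_map_of_isPrime_disjoint (Submonoid.powers f) _ hp hdisj
  refine ⟨Localization.Away f, inferInstance, inferInstance, inferInstance, ?_,
    Algebra.Smooth.of_isLocalization_Away f, hsmooth, p.map (algebraMap A (Localization.Away f)),
    hprime, hcomap, ?_⟩
  · rw [RingHom.comp_id]
    exact (IsScalarTower.algebraMap_eq R₀ A (Localization.Away f)).symm
  · rw [IsScalarTower.algebraMap_eq R₀ A (Localization.Away f), ← Ideal.comap_comap, hcomap]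

end AreSmoothEquivalent


/-! ### Affine normalized models over a valuation ring (§3.3) -/

section models

variable {K : Type u} [Field K]

/-- **Affine normalized `S`-model of `K°`** for `S = Spec k°` (Temkin 2013, §3.3, p. 44:
"`C = Spec(A)` [is] an affine normalized `S`-model of `K°` in the sense that `C` is a normal nft
`S`-scheme with generic point `Spec(K) → C` and such that `K°` is centered on `C`"; nft =
normalized finite type, Definition 2.2.2: a partial normalization of a scheme of finite type),
rendered inside `K` with `k° ↦ R₀ ⊆ K` and `K° ↦ O`: `A ⊆ K` is the integral closure in `K` of
`R₀[f₁, …, f_n]` for finitely many `fᵢ ∈ K°` (proof of Thm. 4.1.1, Step 2, p. 48: "`C' = Spec(A)`,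
where `A` is the normalization of a subring `k̄°[f₁, …, f_n] ⊂ K°`"), and `Frac A = K`. (A normal
domain with fraction field `K` which is a partial normalization of the finite type `k°`-algebra
`A₀ = k°[f]` equals `Nr_K(A₀)`; `K°` is centred on it iff `A ⊆ K°` iff all `fᵢ ∈ K°`, valuation
rings being integrally closed.) [cite: Temkin2013, Section 3.3 (p. 44)] -/
def IsAffineNormalizedModel (O : ValuationSubring K) (R₀ : Subring K) (A : Subring K) : Prop :=
  ∃ s : Finset K, (↑s : Set K) ⊆ (O : Set K) ∧
    (A : Set K) = {x : K | IsIntegral (Subring.closure ((R₀ : Set K) ∪ ↑s)) x} ∧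
    ∀ z : K, ∃ a ∈ A, ∃ b ∈ A, z = a / b

/-- An affine normalized model of `K°` over `k° ⊆ K°` lies in `K°` (valuation rings are
integrally closed) and contains `k°`. [folklore] -/
theorem IsAffineNormalizedModel.le_and_le {O : ValuationSubring K} {R₀ A : Subring K}
    (hR₀ : R₀ ≤ O.toSubring) (h : IsAffineNormalizedModel O R₀ A) :
    A ≤ O.toSubring ∧ R₀ ≤ A := by
  obtain ⟨s, hsO, hA, -⟩ := h
  set C := Subring.closure ((R₀ : Set K) ∪ ↑s) with hC
  have hCO : C ≤ O.toSubring := Subring.closure_le.mpr (Set.union_subset hR₀ hsO)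
  have hmem : ∀ x : K, x ∈ A ↔ IsIntegral C x := fun x => by
    rw [← SetLike.mem_coe, hA]; rfl
  constructor
  · intro x hx
    letI : Algebra C O := (Subring.inclusion hCO).toAlgebra
    haveI : IsScalarTower C O K := IsScalarTower.of_algebraMap_eq (fun _ => rfl)
    have hx' : IsIntegral O x := ((hmem x).1 hx).tower_top
    obtain ⟨y, rfl⟩ := IsIntegrallyClosed.algebraMap_eq_of_integral hx'
    exact y.2
  · intro x hx
    have hxC : x ∈ C := Subring.subset_closure (Set.mem_union_left _ hx)
    exact (hmem x).2 (isIntegral_algebraMap (x := (⟨x, hxC⟩ : C)))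

end models

/-! ### Equicharacteristic valued fields -/

section equichar

variable {k₀ k : Type u} [Field k₀] [Field k] [Algebra k₀ k]

/-- A valued field whose valuation ring contains a field (e.g. the trivially valued ground field
of Temkin's §4) is **equicharacteristic**: its residue field has the same characteristic. This
discharges the characteristic hypothesis of `Temkin2013RelativeCurve` in the paper's application
(proof of Thm. 4.1.1, Step 1: `k = k̄ ⊇` the trivially valued ground field). [folklore] -/
theorem ringChar_residueField_eq_of_algebraMap_mem (Ok : ValuationSubring k)
    (hk₀ : ∀ c : k₀, algebraMap k₀ k c ∈ Ok) :
    ringChar (IsLocalRing.ResidueField Ok) = ringChar k := by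
  letI : Algebra k₀ Ok := ((algebraMap k₀ k).codRestrict Ok hk₀).toAlgebra
  rw [← Algebra.ringChar_eq k₀ (IsLocalRing.ResidueField Ok), ← Algebra.ringChar_eq k₀ k]

end equichar

/-! ### Theorem 3.3.1 (`n = 1`) -/

/-- NAMED FACT — **Temkin's relative one-dimensional inseparable local uniformization**
(Temkin 2013, §3.3, p. 44: "Throughout this section `k` is a valued field of height 1 and
positive characteristic `p`, and `S = Spec(k°)` with generic point `η = Spec(k)`. Let `K/k` be a finitely
generated extension of valued fields of transcendence degree one and let `C = Spec(A)` be an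
affine normalized `S`-model of `K°` … We assume that `K` is of height one and that the
extension `K/k` is transcendentally immediate. … Finally, let `K₁/K, …, K_n/K` be finite
extensions of valued fields. Theorem 3.3.1. Keep the notation of §3.3. Then there exists an
affine normalized `S`-model `C'` which refines `C` and finite extensions of valued fields `l/k`
and `mᵢ/l` for `1 ≤ i ≤ n` such that `l/k` is purely inseparable, `mᵢ/l` are separable, and the
following conditions hold. Let `Lᵢ` denote the field `lKᵢ` with the valuation extending that
of `Kᵢ` and let `zᵢ` denote the center of `Lᵢ°` on `Nr_{Lᵢ}(C')`. Then `zᵢ` is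
smooth-equivalent over `S` to the closed point of `Sᵢ = Spec(mᵢ°)`"), vendored for `n = 1`
(the case used, with `n = 1`, in Step 1 of the proof of Thm. 4.1.1 for `n = 1`) and for `k`
EQUICHARACTERISTIC (`char k̃ = char k`, so positive characteristic as printed, or equal
characteristic `0`, which §3, p. 31, admits: "`p = char(k̃)`. We allow the case of `p = 0` for
the sake of completeness"; NOT mixed characteristic: the proof rests on Thm. 3.2.6, "Let `k` be
an equicharacteristic analytic field …", introduced by "For simplicity, we exclude the mixed
characteristic case now, but see Remark 3.2.8 below", and Remark 3.2.8 only says "It seems that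
Theorem 3.2.6 holds" more generally). Hypotheses, in order: `char k̃ = char k` for the residue
field `k̃` of `k°`; `(k, k°)` of height one; `(K, K°)` with `K° ∩ k = k°`, of height one; `K/k` finitely
generated of transcendence degree `1` and transcendentally immediate (value group torsion over
that of `k` and residue field algebraic over that of `k`: `IsValueTorsionOver ∧
IsResiduallyAlgebraicOver` of `ValuedFunctionFields.lean`, i.e. — definitionally —
`IsTranscendentallyImmediateOver O k ⊤` of `TranscendentallyImmediate.lean`); `C = Spec A` an affine
normalized `Spec k°`-model of `K°` (`IsAffineNormalizedModel`); `K₁/K` finite with `K₁° ∩ K = K°`.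
Conclusion: a refinement `A ⊆ A'` by an affine normalized model; `L₁ ⊇ K₁` finite purely
inseparable with `l ⊆ L₁` finite purely inseparable over `k` and `K₁[l] = L₁` (`L₁ = lK₁`);
`O₁' = L₁°` over `K₁°`; a finite separable extension `m₁/l` with a valuation ring `m₁°` over
`l° = L₁° ∩ l`; and, with `N = Nr_{L₁}(A')` (integral closure of `A'` in `L₁`, `N ⊆ L₁°`) and
`z₁ = 𝔪_{L₁°} ∩ N`: `(Spec N, z₁)` and `(Spec m₁°, 𝔪_{m₁°})` are smooth-equivalent over `k°`
(`AreSmoothEquivalent`, Definition 2.8.1). The printed proof decompletes the Berkovich-analytic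
Thm. 3.2.6 ([Tem3] stable modification); Mathlib has none of it. Users take
`(h : Temkin2013RelativeCurve)`. [cite: Temkin2013, Thm. 3.3.1] -/
def Temkin2013RelativeCurve : Prop :=
  ∀ (k K : Type u) [Field k] [Field K] [Algebra k K]
    (Ok : ValuationSubring k) (O : ValuationSubring K),
    ringChar (IsLocalRing.ResidueField Ok) = ringChar k →
    O.comap (algebraMap k K) = Ok → ringKrullDim Ok = 1 → ringKrullDim O = 1 →
    (⊤ : IntermediateField k K).FG → Algebra.trdeg k K = 1 →
    IsValueTorsionOver O (algebraMap k K).fieldRange ⊤ →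
    IsResiduallyAlgebraicOver O (algebraMap k K).fieldRange ⊤ →
  ∀ A : Subring K, IsAffineNormalizedModel O (Ok.toSubring.map (algebraMap k K)) A →
  ∀ (K₁ : Type u) [Field K₁] [Algebra K K₁], FiniteDimensional K K₁ →
  ∀ O₁ : ValuationSubring K₁, O₁.comap (algebraMap K K₁) = O →
    ∃ A' : Subring K, A ≤ A' ∧ IsAffineNormalizedModel O (Ok.toSubring.map (algebraMap k K)) A' ∧
    ∃ (L₁ : Type u) (_ : Field L₁) (_ : Algebra K₁ L₁) (_ : Algebra K L₁) (_ : Algebra k L₁)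
      (_ : IsScalarTower K K₁ L₁) (_ : IsScalarTower k K L₁),
      FiniteDimensional K₁ L₁ ∧ IsPurelyInseparable K₁ L₁ ∧
    ∃ l : IntermediateField k L₁, FiniteDimensional k l ∧ IsPurelyInseparable k l ∧
      Algebra.adjoin K₁ (l : Set L₁) = ⊤ ∧
    ∃ O₁' : ValuationSubring L₁, O₁'.comap (algebraMap K₁ L₁) = O₁ ∧
    ∃ (m : Type u) (_ : Field m) (_ : Algebra l m) (_ : Algebra k m) (_ : IsScalarTower k l m),
      FiniteDimensional l m ∧ Algebra.IsSeparable l m ∧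
    ∃ Om : ValuationSubring m, Om.comap (algebraMap l m) = O₁'.comap (algebraMap l L₁) ∧
    ∃ (N : Subring L₁) (hN : N ≤ O₁'.toSubring),
      (N : Set L₁) = {x : L₁ | IsIntegral (A'.map (algebraMap K L₁)) x} ∧
    ∃ (hkN : ∀ c : Ok, algebraMap k L₁ c ∈ N) (hkm : ∀ c : Ok, algebraMap k m c ∈ Om),
      AreSmoothEquivalent
        (((algebraMap k L₁).comp Ok.subtype).codRestrict N hkN)
        (((algebraMap k m).comp Ok.subtype).codRestrict Om hkm)
        ((IsLocalRing.maximalIdeal O₁').comap (Subring.inclusion hN : N →+* O₁'))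
        (IsLocalRing.maximalIdeal Om)

end Literature.AlgebraicGeometry.Resolution
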